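import Literature.Probability.Percolation.OneArmSubsequentialLimits
import HarnessLib

/-!
# The one-arm exponent: LSW Theorem 1.2 from the single remaining continuum fact (proofs only)

Topic `Literature/Probability/Percolation`; family `crit-perc`. Def-free companion of
`OneArmScalingLimit.lean`, the home of the named fact
`Literature.Probability.Percolation.LawlerSchrammWerner2002_scalingLimitExponent` — Lawler–Schramm–
Werner, *One-arm exponent for critical 2D percolation*, Electron. J. Probab. **7** (2002), paper
no. 2, **Theorem 1.2** (p. 2): "Let `Q` denote the union of the clusters meeting the unit circle
`∂𝕌` in the scaling limit of critical site percolation on the triangular lattice. There is a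
constant `c > 0` such that for all `r ∈ (0, 1/2)`,
`c⁻¹ r^{5/48} ≤ P[dist(Q, 0) < r] ≤ c r^{5/48}`."

The printed proof (LSW §2, pp. 3–8) has three ingredients:
(i) the probabilistic input — Smirnov's Theorem 2.1 (the `SLE₆` description of `Q(θ)`),
**Lemma 2.2** (the PDE (2.4) `(κ/2) ∂_θ² h + cot(θ/2) ∂_θ h - ∂_t h = 0`, `κ = 6`, for the
hitting function `h(θ, t) = P[𝔯(θ) ≤ e^{-t}]` of (2.2), from the radial Loewner equation
(2.5)–(2.6), the chordal/radial equivalence of `SLE₆` and Itô's formula (2.10)–(2.11)),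
**(2.3)** (`h(0, t) = 0`, RSW) and **Lemma 2.3** (the Neumann condition (2.12) at `θ = 2π`, from
the half-plane three-arm bound (2.13) of Appendix A and (2.14)–(2.16));
(ii) Koebe's one-quarter theorem, giving (2.1) `𝔯/4 ≤ dist(0, Q) ≤ 𝔯`;
(iii) the maximum-principle comparison (2.17) with `H(θ, t) = sin(θ/4)^q e^{-λ t}`,
`λ(6) = (6² - 16)/(32·6) = 5/48`.
In this library (ii), (iii) and the deduction of Theorem 1.2 from (i)–(iii) are theorems
(`Literature.Analysis.Complex.koebeQuarter_holds`, `koebeCovering_const`,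
`LawlerSchrammWerner2002_comparison` in `OneArmMaximumPrinciple.lean`,
`LawlerSchrammWerner2002_thm_1_2_of_hittingPDE` in `OneArmHittingPDE.lean`,
`LawlerSchrammWerner2002_scalingLimitExponent_of_hittingPDE` in `OneArmHittingPDEProofs.lean`),
while (i) is the named fact `LawlerSchrammWerner2002_hittingPDE` (`OneArmHittingPDE.lean`). Its
reading at subsequential limits — ONE datum `(h, h_θ, h_θθ, h_t)` with the properties of
Lemma 2.2, (2.3), Lemma 2.3 (`IsHittingPDEData`) whose value at `θ = 2π` is (2.2),
`h(2π, t) = ν{K | 𝔯(K) ≤ e^{-t}}`, for EVERY weak limit `ν` of `lswLaw` along a sequence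
`R_k → ∞` — is the pair of hypotheses from which `OneArmSubsequentialLimits.lean` proves the
one-arm exponent without the existence of the full scaling limit
(`oneArm_exponent_of_subseqHittingPDE`); in the paper the limit exists (Thm. 2.1, Smirnov), all
subsequential limits coincide, and these hypotheses are (2.2) + Lemma 2.2 + (2.3) + Lemma 2.3
verbatim. They are kept as explicit hypotheses of theorems, not as a named fact: their content
is Smirnov's theorem as LSW use it together with LSW §2, i.e. the proof obligation of
`LawlerSchrammWerner2002_hittingPDE` itself (D-0026 review of the decomposition, 2026-08-15).

This file records that Theorem 1.2, as vendored, follows from the same pair of hypotheses: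

* `LawlerSchrammWerner2002_hittingPDE_of_subseqHittingPDE` — a weak limit of `lswLaw` along the
  reals is a subsequential weak limit along `R_k = k`, so a datum serving every subsequential
  limit serves the limit: the hypotheses give `LawlerSchrammWerner2002_hittingPDE`;
* `LawlerSchrammWerner2002_scalingLimitExponent_of_subseqHittingPDE` — hence Theorem 1.2.

Consequently the discharge `LawlerSchrammWerner2002_scalingLimitExponent_holds` is exactly as
far away as `LawlerSchrammWerner2002_hittingPDE`: the radial-`SLE₆` law of the conformal radius
of the scaling limit (Smirnov's theorem and LSW Lemmas 2.2–2.3), for which the identification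
of (subsequential) scaling limits of percolation with `SLE₆` does not exist in Mathlib or in
this library at present. No new definitions and no new named facts are introduced here.

## Appended: the existence of LSW's scaling limit reduced to the identification of subsequential limits

The other continuum input of `OneArmScalingLimit.lean`, the existence of the scaling limit — the
laws `lswLaw R` of `Q_{1/R}` converge weakly as `R → ∞`, in Lean
`∃ ν : ProbabilityMeasure (NonemptyCompacts ℂ), Tendsto lswLaw atTop (𝓝 ν)` (formerly the named
fact `LawlerSchrammWerner2002_scalingLimit`, merged back into an explicit hypothesis by the D-0026
review of 2026-08-15; LSW §2, p. 3: "Let `Q(θ)` denote a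
random subset of `Ū` whose law is the weak limit as `δ ↓ 0` of the law of `Q_δ(θ)`. (The law of
`Q_δ(θ)` can be thought of as a probability measure on the Hausdorff space of compact subsets of
`Ū`.) By [22, 23], the limit exists", [22] = Smirnov, C. R. Acad. Sci. Paris 333 (2001), [23] =
its long version) — is printed without proof. In the literature the existence of such a scaling
limit has two halves (Smirnov 2001, Thm. 4 and its sketch; Camia–Newman, Comm. Math. Phys. 268
(2006), Thm. 1 with §5 (tightness, after Aizenman–Burchard) and §6 (uniqueness of the limit via
the Cardy–Smirnov formula and `SLE₆`)): (i) existence of subsequential limits and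
(ii) identification of every subsequential limit, which makes them all equal. Half (i) is the
proved `exists_tendsto_lswLaw_subseq` (`OneArmSubsequentialLimits.lean`: all `Q_δ` lie in the
one compact set `subUnitDisc` of compact subsets of `Ū`, so `{lswLaw R}` is tight and
Prokhorov's theorem applies). The appended section PROVES the elementary passage
"(i) + all subsequential limits coincide ⇒ the limit exists" for `lswLaw`, so that what remains
of the existence statement is exactly half (ii) — Smirnov's theorem as LSW use
it (their Thm. 2.1), the Camia–Newman loop ensemble and the passage from loops to the union of
the clusters crossing `∂𝕌` — and nothing topological:

* `subseqLimit_unique_of_scalingLimit` — if the weak limit exists, any two weak limits of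
  `lswLaw` along sequences `R_k → ∞`, `R'_k → ∞` coincide (the topology of weak convergence of
  Borel probability measures on a metric space is Hausdorff);
* `LawlerSchrammWerner2002_scalingLimit_of_subseqLimit_unique` — conversely, if any two such
  subsequential weak limits coincide, `lswLaw R` converges weakly as `R → ∞` (Billingsley,
  *Convergence of Probability Measures*, 2nd ed. (1999), Thm. 2.6 — "`P_n ⇒ P` iff every
  subsequence has a further subsequence converging weakly to `P`" — with Prokhorov's Thm. 5.1;
  in Mathlib `Filter.tendsto_of_subseq_tendsto`, `atTop` on `ℝ` being countably generated);
* `LawlerSchrammWerner2002_scalingLimit_iff_subseqLimit_unique` — the equivalence;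
* `tendsto_lswLaw_of_forall_subseqLimit_eq`,
  `LawlerSchrammWerner2002_scalingLimit_of_forall_subseqLimit_eq` — the working form for
  half (ii): it suffices to exhibit ONE Borel probability measure `μ` on the Hausdorff space with
  which every subsequential weak limit of `lswLaw` coincides; the weak limit is then `μ`.

Again no new definitions and no new named facts (half (ii) is Smirnov 2001 / Camia–Newman 2006,
not in Mathlib or this library; the one-arm cone does not need it, cf.
`oneArm_exponent_of_subseqHittingPDE`).
Mathlib used: `Filter.tendsto_of_subseq_tendsto`, `Filter.atTop_isCountablyGenerated_of_archimedean`,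
`tendsto_nhds_unique`.


## References

* G. F. Lawler, O. Schramm, W. Werner, *One-arm exponent for critical 2D percolation*, Electron.
  J. Probab. 7 (2002), no. 2 — Thm. 1.2 (p. 2), Thm. 2.1 (p. 3), (2.1)–(2.3), Lemma 2.2 (p. 4),
  Lemma 2.3, (2.12) (p. 6), (2.17) (pp. 7–8) [LawlerSchrammWernerEJP2002].
* S. Smirnov, *Critical percolation in the plane: conformal invariance, Cardy's formula, scaling
  limits*, C. R. Acad. Sci. Paris 333 (2001) 239–244, Thm. 4 [Smirnov2001].
* F. Camia, C. M. Newman, *Two-dimensional critical percolation: the full scaling limit*, Comm.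
  Math. Phys. 268 (2006) 1–38, Thm. 1, §5–§6 [CamiaNewman2006].
* P. Billingsley, *Convergence of Probability Measures*, 2nd ed. (1999), Thm. 2.6, Thm. 5.1
  [Billingsley1999].
-/

noncomputable section

open MeasureTheory Filter Topology

namespace Literature.Probability.Percolation

/-- **LSW §2 at the limit from LSW §2 at subsequential limits.** If one hitting datum
`(h, h_θ, h_θθ, h_t)` with the properties of Lemma 2.2, (2.3), Lemma 2.3 (`IsHittingPDEData`)
satisfies (2.2) at `θ = 2π`, `h(2π, t) = ν{K | 𝔯(K) ≤ e^{-t}}`, for every weak limit `ν` of the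
laws `lswLaw R` of `Q_{1/R}` along a sequence `R_k → ∞` (the hypotheses of
`oneArm_exponent_of_subseqHittingPDE`), then it serves every weak limit `ν` of `lswLaw` along
the reals, i.e. `LawlerSchrammWerner2002_hittingPDE` holds: `ν` is the limit along `R_k = k`.
[cite: LawlerSchrammWernerEJP2002, §2: (2.2), Lemma 2.2 (p. 4), (2.3) (p. 4), Lemma 2.3 (p. 6)] -/
theorem LawlerSchrammWerner2002_hittingPDE_of_subseqHittingPDE {h hθ hθθ ht : ℝ → ℝ → ℝ}
    (H : IsHittingPDEData h hθ hθθ ht)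
    (hid : ∀ (R : ℕ → ℝ) (ν : ProbabilityMeasure (TopologicalSpace.NonemptyCompacts ℂ)),
      Tendsto R atTop atTop → Tendsto (lswLaw ∘ R) atTop (𝓝 ν) →
        ∀ t, h (2 * Real.pi) t = (ν : Measure (TopologicalSpace.NonemptyCompacts ℂ)).real
          {K | Literature.Analysis.Complex.conformalRadius (K : Set ℂ) ≤ Real.exp (-t)}) :
    LawlerSchrammWerner2002_hittingPDE := by
  intro ν hν
  exact ⟨h, hθ, hθθ, ht,
    hid (fun k : ℕ => (k : ℝ)) ν tendsto_natCast_atTop_atTop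
      (hν.comp tendsto_natCast_atTop_atTop),
    H.antitone, H.mem_Icc, H.pos, H.hasDerivAt, H.continuousOn_θ, H.continuousOn_θθ,
    H.continuousOn_t, H.pde, H.dirichlet, H.neumann⟩

/-- **LSW Theorem 1.2 from LSW §2 at subsequential limits**: a hitting datum with the
properties of Lemma 2.2, (2.3), Lemma 2.3, identified at `θ = 2π` with every subsequential weak
limit of `lswLaw` through (2.2), gives Theorem 1.2 as vendored
(`LawlerSchrammWerner2002_scalingLimitExponent`), via
`LawlerSchrammWerner2002_scalingLimitExponent_of_hittingPDE` (maximum principle (2.17), Koebe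
covering, (2.1), all proved). [cite: LawlerSchrammWernerEJP2002, Thm. 1.2 (p. 2) and its proof (pp. 3–8)] -/
theorem LawlerSchrammWerner2002_scalingLimitExponent_of_subseqHittingPDE {h hθ hθθ ht : ℝ → ℝ → ℝ}
    (H : IsHittingPDEData h hθ hθθ ht)
    (hid : ∀ (R : ℕ → ℝ) (ν : ProbabilityMeasure (TopologicalSpace.NonemptyCompacts ℂ)),
      Tendsto R atTop atTop → Tendsto (lswLaw ∘ R) atTop (𝓝 ν) →
        ∀ t, h (2 * Real.pi) t = (ν : Measure (TopologicalSpace.NonemptyCompacts ℂ)).real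
          {K | Literature.Analysis.Complex.conformalRadius (K : Set ℂ) ≤ Real.exp (-t)}) :
    LawlerSchrammWerner2002_scalingLimitExponent :=
  LawlerSchrammWerner2002_scalingLimitExponent_of_hittingPDE
    (LawlerSchrammWerner2002_hittingPDE_of_subseqHittingPDE H hid)

/-! ### Appended: existence of the weak limit of `lswLaw` ⇔ uniqueness of subsequential weak limits -/

open TopologicalSpace

/-- **Subsequential weak limits of `Q_δ` are unique once the limit exists**: if `lswLaw R`
converges weakly as `R → ∞`, then any two weak limits of `lswLaw` along sequences `R_k → ∞` and
`R'_k → ∞` coincide (weak limits of Borel probability measures on a metric space are unique;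
Billingsley 1999, Thm. 1.2 and the remark after Thm. 2.6). [cite: Billingsley1999, Thm 2.6] -/
theorem subseqLimit_unique_of_scalingLimit
    (h : ∃ ν : ProbabilityMeasure (NonemptyCompacts ℂ), Tendsto lswLaw atTop (𝓝 ν))
    {R R' : ℕ → ℝ} {ν ν' : ProbabilityMeasure (NonemptyCompacts ℂ)}
    (hR : Tendsto R atTop atTop) (hν : Tendsto (lswLaw ∘ R) atTop (𝓝 ν))
    (hR' : Tendsto R' atTop atTop) (hν' : Tendsto (lswLaw ∘ R') atTop (𝓝 ν')) : ν = ν' := by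
  obtain ⟨μ, hμ⟩ := h
  rw [tendsto_nhds_unique hν (hμ.comp hR), tendsto_nhds_unique hν' (hμ.comp hR')]

/-- **LSW's scaling limit exists as soon as its subsequential limits coincide** (the topological
half of "By [22, 23], the limit exists", LSW 2002, §2, p. 3): if any two weak limits of `lswLaw`
along sequences `R_k → ∞`, `R'_k → ∞` are equal, then the laws `lswLaw R` of `Q_{1/R}` converge
weakly as `R → ∞` (LSW's "the limit exists", §2, p. 3). Proof: fix one
subsequential limit `ν₀` (it exists by `exists_tendsto_lswLaw_subseq`, tightness being free);
`atTop` on `ℝ` is countably generated, so by `Filter.tendsto_of_subseq_tendsto` it suffices that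
every sequence `R_k → ∞` has a subsequence along which `lswLaw` tends to `ν₀` — extract a
convergent subsequence (Prokhorov, `exists_tendsto_lswLaw_subseq`) and use the hypothesis to
identify its limit with `ν₀` (Billingsley 1999, Thm. 2.6 with Thm. 5.1).
[cite: Billingsley1999, Thm 2.6 and Thm 5.1] [cite: LawlerSchrammWernerEJP2002, §2 (p. 3)] -/
theorem LawlerSchrammWerner2002_scalingLimit_of_subseqLimit_unique
    (h : ∀ (R R' : ℕ → ℝ) (ν ν' : ProbabilityMeasure (NonemptyCompacts ℂ)),
      Tendsto R atTop atTop → Tendsto (lswLaw ∘ R) atTop (𝓝 ν) →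
        Tendsto R' atTop atTop → Tendsto (lswLaw ∘ R') atTop (𝓝 ν') → ν = ν') :
    ∃ ν : ProbabilityMeasure (NonemptyCompacts ℂ), Tendsto lswLaw atTop (𝓝 ν) := by
  -- a reference subsequential limit `ν₀` along the integer meshes `R_k = k`
  obtain ⟨ν₀, φ₀, hφ₀, h₀⟩ := exists_tendsto_lswLaw_subseq fun k : ℕ => (k : ℝ)
  have hR₀ : Tendsto ((fun k : ℕ => (k : ℝ)) ∘ φ₀) atTop atTop :=
    tendsto_natCast_atTop_atTop.comp hφ₀.tendsto_atTop
  refine ⟨ν₀, Filter.tendsto_of_subseq_tendsto fun R hR => ?_⟩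
  -- every sequence `R_k → ∞` has a subsequence along which `lswLaw` converges, to `ν₀` by `h`
  obtain ⟨ν, φ, hφ, hν⟩ := exists_tendsto_lswLaw_subseq R
  have hνeq : ν = ν₀ := h (R ∘ φ) _ ν ν₀ (hR.comp hφ.tendsto_atTop) hν hR₀ h₀
  rw [← hνeq]
  exact ⟨φ, hν⟩

/-- **The weak limit of `lswLaw` exists ⇔ uniqueness of subsequential limits**: the laws
of `Q_{1/R}` converge weakly as `R → ∞` if and only if any two weak limits of `lswLaw` along
sequences tending to `∞` coincide. The forward direction is the Hausdorff property of weak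
convergence, the backward one tightness (free here) + Prokhorov + Billingsley's Thm. 2.6; the
remaining content of the named fact is thus the identification of subsequential limits
(Smirnov 2001, Thm. 4; Camia–Newman 2006, Thm. 1, §6). [cite: Billingsley1999, Thm 2.6 and Thm 5.1] -/
theorem LawlerSchrammWerner2002_scalingLimit_iff_subseqLimit_unique :
    (∃ ν : ProbabilityMeasure (NonemptyCompacts ℂ), Tendsto lswLaw atTop (𝓝 ν)) ↔
      ∀ (R R' : ℕ → ℝ) (ν ν' : ProbabilityMeasure (NonemptyCompacts ℂ)),
        Tendsto R atTop atTop → Tendsto (lswLaw ∘ R) atTop (𝓝 ν) →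
          Tendsto R' atTop atTop → Tendsto (lswLaw ∘ R') atTop (𝓝 ν') → ν = ν' :=
  ⟨fun h _ _ _ _ hR hν hR' hν' => subseqLimit_unique_of_scalingLimit h hR hν hR' hν',
    LawlerSchrammWerner2002_scalingLimit_of_subseqLimit_unique⟩

/-- **Working form of the identification half**: to prove that the weak limit of `lswLaw` exists
it suffices to exhibit one Borel probability measure `μ` on the Hausdorff space `NonemptyCompacts ℂ`
— in the literature the law of LSW's `Q(2π)`, described through `SLE₆` (LSW 2002, Thm. 2.1
(Smirnov)) or through the Camia–Newman loop ensemble — with which every weak limit of `lswLaw`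
along a sequence `R_k → ∞` coincides; the weak limit of `lswLaw R` as `R → ∞` is then `μ`.
[cite: LawlerSchrammWernerEJP2002, §2 (p. 3) and Thm. 2.1] [cite: Billingsley1999, Thm 2.6] -/
theorem tendsto_lswLaw_of_forall_subseqLimit_eq
    (μ : ProbabilityMeasure (NonemptyCompacts ℂ))
    (h : ∀ (R : ℕ → ℝ) (ν : ProbabilityMeasure (NonemptyCompacts ℂ)),
      Tendsto R atTop atTop → Tendsto (lswLaw ∘ R) atTop (𝓝 ν) → ν = μ) :
    Tendsto lswLaw atTop (𝓝 μ) := by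
  refine Filter.tendsto_of_subseq_tendsto fun R hR => ?_
  obtain ⟨ν, φ, hφ, hν⟩ := exists_tendsto_lswLaw_subseq R
  rw [← h (R ∘ φ) ν (hR.comp hφ.tendsto_atTop) hν]
  exact ⟨φ, hν⟩

/-- **The working form gives the existence of the scaling limit**: one Borel probability measure
`μ` on the Hausdorff space with which every subsequential weak limit of `lswLaw` (along sequences
`R_k → ∞`) coincides gives the weak convergence of `lswLaw R` as `R → ∞`, with limit `μ`.
[cite: LawlerSchrammWernerEJP2002, §2 (p. 3)] [cite: Billingsley1999, Thm 2.6] -/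
theorem LawlerSchrammWerner2002_scalingLimit_of_forall_subseqLimit_eq
    (μ : ProbabilityMeasure (NonemptyCompacts ℂ))
    (h : ∀ (R : ℕ → ℝ) (ν : ProbabilityMeasure (NonemptyCompacts ℂ)),
      Tendsto R atTop atTop → Tendsto (lswLaw ∘ R) atTop (𝓝 ν) → ν = μ) :
    ∃ ν : ProbabilityMeasure (NonemptyCompacts ℂ), Tendsto lswLaw atTop (𝓝 ν) :=
  ⟨μ, tendsto_lswLaw_of_forall_subseqLimit_eq μ h⟩

end Literature.Probability.Percolation
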